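import Literature.MathematicalPhysics.QuantumLattice.JordanWignerTwist
import HarnessLib

/-!
# Jordan–Wigner versus isotony, II(b): final segments and the even subalgebra

Topic `MathematicalPhysics/QuantumLattice`; namespace `Literature.MathematicalPhysics.QuantumLattice.JordanWigner`.
Sequel of `JordanWignerEmbedding.lean` (initial segments) and `JordanWignerTwist.lean` (bookkeeping). Everything here is a
PROVED theorem; no definition, no named fact.

For an order embedding `φ : Λ₁ ↪o Λ₂` whose image is an UPPER set (a final segment of the site order) the CAR isotony
`Γ^{CAR}_φ` and the spin isotony `Γ^{spin}_φ` differ by the strings below the block, `P_below = ⨂_{z ∉ im φ} F_z`: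

* **`toSpin_fermionEmbed_eq_twist`** (all `A`): with `u = P_below`, `Q = Γ^{spin}_φ(⨂F)` the block parity and the unit
  `v = ½(1+u) + ½(1−u)Q` (`v² = 1`), `toSpin (Γ^{CAR}_φ A) = v · Γ^{spin}_φ (toSpin A) · v`; PROOF: both sides are algebra
  homomorphisms agreeing on every `c_{xσ}, c†_{xσ}` (`algHom_ext_car`), since `jwString (φ x) = u · Γ^{spin}_φ(jwString x)`;
* **`toSpin_fermionEmbed_of_isUpperSet_of_even`** — for EVEN `A` (`Θ A = A`): `toSpin (Γ^{CAR}_φ A) = Γ^{spin}_φ (toSpin A)`;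
* **`toSpin_fermionEmbed_of_isUpperSet_of_odd`** — for ODD `A` (`Θ A = -A`): `toSpin (Γ^{CAR}_φ A) = P_below · Γ^{spin}_φ (toSpin A)`.

This is the matrix form of the standard fact that the EVEN part of a local CAR algebra sits inside the spin chain as a
genuine tensor factor while odd elements carry the string (Araki–Moriya 2003 §4.1: `𝔄(I)₊` and graded locality; Essler et
al. §12.3.4 (12.198)–(12.201); Bratteli–Robinson II §5.2.2 Thm. 5.2.5). Consumers: the by-value transport of
translation-invariant fermionic SDP relaxations (`Summits/Ventures/CertifiedManyBodySolver/Transport`, lane B): the window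
density matrix of an EVEN state is locally translation invariant as a matrix in the Jordan–Wigner product basis.

## References

* H. Araki, H. Moriya, Rev. Math. Phys. 15 (2003) 93, §4.1–4.2. [cite: ArakiMoriya2003, §4.1 Def. 4.1–4.3]
* F. H. L. Essler et al., *The One-Dimensional Hubbard Model*, CUP (2005), §12.3.4 eqs. (12.196)–(12.201).
  [cite: EsslerEtAl2005, §12.3.4 eqs. (12.196)–(12.201)]
* O. Bratteli, D. W. Robinson, *OAQSM 2*, 2nd ed., §5.2.2 Thm. 5.2.5. [cite: BratteliRobinsonII1997, §5.2.2 Thm. 5.2.5]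
-/

noncomputable section

namespace Literature.MathematicalPhysics.QuantumLattice

open Matrix Finset HubbardWave0

namespace JordanWigner

/-! ### Ring identities for the twist `v = p + m Q` (`p, m` complementary idempotents commuting with `Q`, `Q² = 1`) -/

section TwistAlgebra

variable {R : Type*} [Ring R]

/-- `v² = 1` for `v = p + mQ`. [folklore] -/
private theorem twist_mul_self {p m Q : R} (hpm1 : p + m = 1) (hpm : p * m = 0) (hmp : m * p = 0) (hpp : p * p = p)
    (hmm : m * m = m) (hQQ : Q * Q = 1) (hmQ : m * Q = Q * m) (hpQ : p * Q = Q * p) :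
    (p + m * Q) * (p + m * Q) = 1 := by
  have h1 : m * Q * p = 0 := by rw [mul_assoc, ← hpQ, ← mul_assoc, hmp, zero_mul]
  have h2 : m * Q * (m * Q) = m := by
    rw [mul_assoc, ← mul_assoc Q m Q, ← hmQ, mul_assoc m Q Q, hQQ, mul_one, hmm]
  rw [add_mul, mul_add, mul_add, hpp, ← mul_assoc p m Q, hpm, zero_mul, add_zero, h1, zero_add, h2, hpm1]

/-- `v g v = g` when `g` commutes with `p`, `m` and `Q`. [folklore] -/
private theorem twist_conj_of_commute {p m Q g : R} (hpm1 : p + m = 1) (hpm : p * m = 0) (hmp : m * p = 0)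
    (hpp : p * p = p) (hmm : m * m = m) (hQQ : Q * Q = 1) (hmQ : m * Q = Q * m) (hpQ : p * Q = Q * p)
    (hpg : p * g = g * p) (hmg : m * g = g * m) (hQg : Q * g = g * Q) :
    (p + m * Q) * g * (p + m * Q) = g := by
  have e1 : p * g * p = g * p := by rw [hpg, mul_assoc, hpp]
  have e2 : p * g * (m * Q) = 0 := by rw [hpg, mul_assoc, ← mul_assoc p m Q, hpm, zero_mul, mul_zero]
  have e3 : m * Q * g * p = 0 := by
    rw [mul_assoc m Q g, hQg, ← mul_assoc m g Q, hmg, mul_assoc (g * m) Q p, ← hpQ, ← mul_assoc (g * m) p Q,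
      mul_assoc g m p, hmp, mul_zero, zero_mul]
  have e4 : m * Q * g * (m * Q) = g * m := by
    rw [mul_assoc m Q g, hQg, ← mul_assoc m g Q, hmg, mul_assoc (g * m) Q (m * Q), ← mul_assoc Q m Q, ← hmQ,
      mul_assoc m Q Q, hQQ, mul_one, mul_assoc g m m, hmm]
  rw [add_mul, add_mul, mul_add, mul_add, e1, e2, add_zero, e3, zero_add, e4, ← mul_add, hpm1, mul_one]

/-- `v g v = (p − m) g` when `g` commutes with `p`, `m` and ANTIcommutes with `Q`. [folklore] -/
private theorem twist_conj_of_anticommute {p m Q g : R} (hpm : p * m = 0) (hmp : m * p = 0)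
    (hpp : p * p = p) (hmm : m * m = m) (hQQ : Q * Q = 1) (hmQ : m * Q = Q * m) (hpQ : p * Q = Q * p)
    (hpg : p * g = g * p) (hmg : m * g = g * m) (hQg : Q * g = -(g * Q)) :
    (p + m * Q) * g * (p + m * Q) = (p - m) * g := by
  have e1 : p * g * p = g * p := by rw [hpg, mul_assoc, hpp]
  have e2 : p * g * (m * Q) = 0 := by rw [hpg, mul_assoc, ← mul_assoc p m Q, hpm, zero_mul, mul_zero]
  have e3 : m * Q * g * p = 0 := by
    rw [mul_assoc m Q g, hQg, mul_neg, neg_mul, ← mul_assoc m g Q, hmg, mul_assoc (g * m) Q p, ← hpQ,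
      ← mul_assoc (g * m) p Q, mul_assoc g m p, hmp, mul_zero, zero_mul, neg_zero]
  have e4 : m * Q * g * (m * Q) = -(g * m) := by
    rw [mul_assoc m Q g, hQg, mul_neg, neg_mul, ← mul_assoc m g Q, hmg, mul_assoc (g * m) Q (m * Q),
      ← mul_assoc Q m Q, ← hmQ, mul_assoc m Q Q, hQQ, mul_one, mul_assoc g m m, hmm]
  rw [add_mul, add_mul, mul_add, mul_add, e1, e2, add_zero, e3, zero_add, e4, ← sub_eq_add_neg, sub_mul, hpg, hmg]

variable [Algebra ℂ R]

/-- The spectral projections `p = ½(1+u)`, `m = ½(1−u)` of an involution `u` (`u² = 1`):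
`p + m = 1`, `pm = mp = 0`, `p² = p`, `m² = m`, `p − m = u`. [folklore] -/
private theorem involution_proj {u : R} (hu : u * u = 1) :
    (1 / 2 : ℂ) • (1 + u) + (1 / 2 : ℂ) • (1 - u) = 1 ∧
    ((1 / 2 : ℂ) • (1 + u)) * ((1 / 2 : ℂ) • (1 - u)) = 0 ∧
    ((1 / 2 : ℂ) • (1 - u)) * ((1 / 2 : ℂ) • (1 + u)) = 0 ∧
    ((1 / 2 : ℂ) • (1 + u)) * ((1 / 2 : ℂ) • (1 + u)) = (1 / 2 : ℂ) • (1 + u) ∧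
    ((1 / 2 : ℂ) • (1 - u)) * ((1 / 2 : ℂ) • (1 - u)) = (1 / 2 : ℂ) • (1 - u) ∧
    (1 / 2 : ℂ) • (1 + u) - (1 / 2 : ℂ) • (1 - u) = u := by
  have two : (1 : R) + 1 = (2 : ℂ) • (1 : R) := by rw [two_smul]
  refine ⟨?_, ?_, ?_, ?_, ?_, ?_⟩
  · rw [← smul_add, show (1 + u) + (1 - u) = (1 : R) + 1 by abel, two, smul_smul]
    norm_num
  · rw [smul_mul_smul_comm, show (1 + u) * (1 - u) = (1 : R) - u * u by noncomm_ring, hu, sub_self, smul_zero]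
  · rw [smul_mul_smul_comm, show (1 - u) * (1 + u) = (1 : R) - u * u by noncomm_ring, hu, sub_self, smul_zero]
  · rw [smul_mul_smul_comm, show (1 + u) * (1 + u) = (1 : R) + u + u + u * u by noncomm_ring, hu,
      show (1 : R) + u + u + 1 = ((1 : R) + 1) + (u + u) by abel, two, ← two_smul ℂ u, ← smul_add, smul_smul]
    norm_num
  · rw [smul_mul_smul_comm, show (1 - u) * (1 - u) = (1 : R) - u - u + u * u by noncomm_ring, hu,
      show (1 : R) - u - u + 1 = ((1 : R) + 1) - (u + u) by abel, two, ← two_smul ℂ u, ← smul_sub, smul_smul]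
    norm_num
  · rw [← smul_sub, show (1 + u) - (1 - u) = u + u by abel, ← two_smul ℂ u, smul_smul]
    norm_num

end TwistAlgebra


section UpperSet

variable {Λ₁ Λ₂ : Type*} [LinearOrder Λ₁] [Fintype Λ₁] [LinearOrder Λ₂] [Fintype Λ₂]


/-- **The twisted isotony formula (all `A`).** With `u = P_below`, `Q` the block parity and `v = ½(1+u) + ½(1−u)Q`:
`toSpin (Γ^{CAR}_φ A) = v · Γ^{spin}_φ (toSpin A) · v`. [cite: ArakiMoriya2003, §4.1 Def. 4.1–4.3]
[cite: EsslerEtAl2005, §12.3.4 eqs. (12.198)–(12.201)] -/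
theorem toSpin_fermionEmbed_eq_twist (φ : Λ₁ ↪o Λ₂) (hφ : IsUpperSet (Set.range φ))
    (A : Matrix (Finset (Orb Λ₁)) (Finset (Orb Λ₁)) ℂ) :
    toSpin (fermionEmbed φ.toEmbedding A) =
      ((1 / 2 : ℂ) • (1 + productOp (fun z : Λ₂ => if z ∈ rangeSites φ.toEmbedding then (1 : Matrix (Fin 4) (Fin 4) ℂ)
          else siteParity)) +
        ((1 / 2 : ℂ) • (1 - productOp (fun z : Λ₂ => if z ∈ rangeSites φ.toEmbedding then (1 : Matrix (Fin 4) (Fin 4) ℂ)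
          else siteParity))) *
          productOp (fun z : Λ₂ => if z ∈ rangeSites φ.toEmbedding then siteParity else (1 : Matrix (Fin 4) (Fin 4) ℂ))) *
      spinEmbed φ.toEmbedding (toSpin A) *
      ((1 / 2 : ℂ) • (1 + productOp (fun z : Λ₂ => if z ∈ rangeSites φ.toEmbedding then (1 : Matrix (Fin 4) (Fin 4) ℂ)
          else siteParity)) +
        ((1 / 2 : ℂ) • (1 - productOp (fun z : Λ₂ => if z ∈ rangeSites φ.toEmbedding then (1 : Matrix (Fin 4) (Fin 4) ℂ)
          else siteParity))) *
          productOp (fun z : Λ₂ => if z ∈ rangeSites φ.toEmbedding then siteParity else (1 : Matrix (Fin 4) (Fin 4) ℂ))) := by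
  -- names
  set u : Op Λ₂ 4 := productOp (fun z : Λ₂ => if z ∈ rangeSites φ.toEmbedding then (1 : Matrix (Fin 4) (Fin 4) ℂ)
    else siteParity) with hudef
  set Q : Op Λ₂ 4 := productOp (fun z : Λ₂ => if z ∈ rangeSites φ.toEmbedding then siteParity
    else (1 : Matrix (Fin 4) (Fin 4) ℂ)) with hQdef
  set p : Op Λ₂ 4 := (1 / 2 : ℂ) • (1 + u) with hpdef
  set m : Op Λ₂ 4 := (1 / 2 : ℂ) • (1 - u) with hmdef
  set g : Matrix (Finset (Orb Λ₁)) (Finset (Orb Λ₁)) ℂ →ₐ[ℂ] Op Λ₂ 4 :=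
    (spinEmbed (q := 4) φ.toEmbedding).comp (toSpin (Λ := Λ₁)).toAlgHom with hgdef
  have hg : ∀ B, g B = spinEmbed φ.toEmbedding (toSpin B) := fun B => rfl
  -- relations
  have hu : u * u = 1 := productOp_below_mul_self φ
  have hQQ : Q * Q = 1 := blockParity_mul_self φ
  have huQ : u * Q = Q * u := productOp_below_mul_blockParity_comm φ
  obtain ⟨hpm1, hpm, hmp, hpp, hmm, hpmu⟩ := involution_proj (R := Op Λ₂ 4) hu
  have hug : ∀ B, u * g B = g B * u := fun B => productOp_below_mul_spinEmbed_comm φ (toSpin B)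
  have hpQ : p * Q = Q * p := by rw [hpdef, smul_mul_assoc, mul_smul_comm, add_mul, mul_add, one_mul, mul_one, huQ]
  have hmQ : m * Q = Q * m := by rw [hmdef, smul_mul_assoc, mul_smul_comm, sub_mul, mul_sub, one_mul, mul_one, huQ]
  have hpg : ∀ B, p * g B = g B * p := fun B => by
    rw [hpdef, smul_mul_assoc, mul_smul_comm, add_mul, mul_add, one_mul, mul_one, hug]
  have hmg : ∀ B, m * g B = g B * m := fun B => by
    rw [hmdef, smul_mul_assoc, mul_smul_comm, sub_mul, mul_sub, one_mul, mul_one, hug]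
  have hvv : (p + m * Q) * (p + m * Q) = 1 := twist_mul_self hpm1 hpm hmp hpp hmm hQQ hmQ hpQ
  -- parity-odd elements anticommute with the block parity under `g`
  have hQodd : ∀ B, parityAut B = -B → Q * g B = -(g B * Q) := by
    intro B hB
    have h1 : g (parityAut B) = Q * g B * Q := by rw [hg, hg, spinEmbed_toSpin_parityAut]
    rw [hB, map_neg] at h1
    have h2 : Q * g B * Q * Q = -g B * Q := by rw [← h1]
    rw [mul_assoc, hQQ, mul_one, neg_mul] at h2
    exact h2
  have huo : ∀ (y : Λ₁) (a : Matrix (Fin 4) (Fin 4) ℂ),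
      u * onSite (φ.toEmbedding y) a = onSite (φ.toEmbedding y) a * u := by
    intro y a
    rw [← spinEmbed_onSite φ.toEmbedding]
    exact productOp_below_mul_spinEmbed_comm φ _
  -- the twisted homomorphism `B ↦ v g(B) v`
  set v : Op Λ₂ 4 := p + m * Q with hvdef
  clear_value v
  let h : Matrix (Finset (Orb Λ₁)) (Finset (Orb Λ₁)) ℂ →ₐ[ℂ] Op Λ₂ 4 :=
    { toFun := fun B => v * g B * v
      map_one' := by rw [map_one, mul_one, hvv]
      map_mul' := fun B C => by
        rw [map_mul]
        calc v * (g B * g C) * v = v * g B * (v * v) * g C * v := by rw [hvv, mul_one, mul_assoc v (g B) (g C)]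
          _ = v * g B * v * (v * g C * v) := by simp only [mul_assoc]
      map_zero' := by rw [map_zero, mul_zero, zero_mul]
      map_add' := fun B C => by rw [map_add, mul_add, add_mul]
      commutes' := fun c => by
        rw [AlgHom.commutes, Algebra.algebraMap_eq_smul_one, mul_smul_comm, mul_one, smul_mul_assoc, hvv] }
  have hh : ∀ B, h B = v * g B * v := fun B => rfl
  -- the two homomorphisms agree on the generators
  have key : ((toSpin (Λ := Λ₂)).toAlgHom).comp (fermionEmbed φ.toEmbedding) = h := by
    refine algHom_ext_car (fun i => ?_) (fun i => ?_)
    · have hi : i = orb (ofLex i).1 (ofLex i).2 := rfl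
      rw [hi, hh, hvdef]
      change toSpin (fermionEmbed φ.toEmbedding (annihilation (orb (ofLex i).1 (ofLex i).2))) = _
      have hodd : parityAut (annihilation (orb (ofLex i).1 (ofLex i).2) : Matrix (Finset (Orb Λ₁)) (Finset (Orb Λ₁)) ℂ) =
          -annihilation (orb (ofLex i).1 (ofLex i).2) := parityAut_annihilation _
      rw [twist_conj_of_anticommute hpm hmp hpp hmm hQQ hmQ hpQ (hpg _) (hmg _) (hQodd _ hodd), hpmu, hg,
        fermionEmbed_annihilation, toSpin_annihilation, toSpin_annihilation, map_mul, spinEmbed_onSite,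
        jwString_eq_of_isUpperSet φ hφ, mul_assoc]
    · have hi : i = orb (ofLex i).1 (ofLex i).2 := rfl
      rw [hi, hh, hvdef]
      change toSpin (fermionEmbed φ.toEmbedding (creation (orb (ofLex i).1 (ofLex i).2))) = _
      have hodd : parityAut (creation (orb (ofLex i).1 (ofLex i).2) : Matrix (Finset (Orb Λ₁)) (Finset (Orb Λ₁)) ℂ) =
          -creation (orb (ofLex i).1 (ofLex i).2) := parityAut_creation _
      rw [twist_conj_of_anticommute hpm hmp hpp hmm hQQ hmQ hpQ (hpg _) (hmg _) (hQodd _ hodd), hpmu, hg,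
        fermionEmbed_creation, toSpin_creation, toSpin_creation, map_mul, spinEmbed_onSite]
      conv_lhs => rw [jwString_eq_of_isUpperSet φ hφ, ← mul_assoc, ← huo, mul_assoc]
  have hA := congrArg (fun f : Matrix (Finset (Orb Λ₁)) (Finset (Orb Λ₁)) ℂ →ₐ[ℂ] Op Λ₂ 4 => f A) key
  exact hA

/-- **Jordan–Wigner ∘ CAR-isotony = spin-isotony ∘ Jordan–Wigner on EVEN elements of a final segment.** For an order
embedding `φ` onto an upper set and `Θ A = A`: `toSpin (Γ^{CAR}_φ A) = Γ^{spin}_φ (toSpin A)`.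
[cite: ArakiMoriya2003, §4.1 Def. 4.1–4.3] [cite: EsslerEtAl2005, §12.3.4 eqs. (12.198)–(12.201)] -/
theorem toSpin_fermionEmbed_of_isUpperSet_of_even (φ : Λ₁ ↪o Λ₂) (hφ : IsUpperSet (Set.range φ))
    {A : Matrix (Finset (Orb Λ₁)) (Finset (Orb Λ₁)) ℂ} (hA : parityAut A = A) :
    toSpin (fermionEmbed φ.toEmbedding A) = spinEmbed φ.toEmbedding (toSpin A) := by
  set u : Op Λ₂ 4 := productOp (fun z : Λ₂ => if z ∈ rangeSites φ.toEmbedding then (1 : Matrix (Fin 4) (Fin 4) ℂ)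
    else siteParity) with hudef
  set Q : Op Λ₂ 4 := productOp (fun z : Λ₂ => if z ∈ rangeSites φ.toEmbedding then siteParity
    else (1 : Matrix (Fin 4) (Fin 4) ℂ)) with hQdef
  have hu : u * u = 1 := productOp_below_mul_self φ
  have hQQ : Q * Q = 1 := blockParity_mul_self φ
  have huQ : u * Q = Q * u := productOp_below_mul_blockParity_comm φ
  obtain ⟨hpm1, hpm, hmp, hpp, hmm, -⟩ := involution_proj (R := Op Λ₂ 4) hu
  have hug : u * spinEmbed φ.toEmbedding (toSpin A) = spinEmbed φ.toEmbedding (toSpin A) * u :=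
    productOp_below_mul_spinEmbed_comm φ (toSpin A)
  have hpQ : (1 / 2 : ℂ) • (1 + u) * Q = Q * ((1 / 2 : ℂ) • (1 + u)) := by
    rw [smul_mul_assoc, mul_smul_comm, add_mul, mul_add, one_mul, mul_one, huQ]
  have hmQ : (1 / 2 : ℂ) • (1 - u) * Q = Q * ((1 / 2 : ℂ) • (1 - u)) := by
    rw [smul_mul_assoc, mul_smul_comm, sub_mul, mul_sub, one_mul, mul_one, huQ]
  have hpg : (1 / 2 : ℂ) • (1 + u) * spinEmbed φ.toEmbedding (toSpin A) =
      spinEmbed φ.toEmbedding (toSpin A) * ((1 / 2 : ℂ) • (1 + u)) := by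
    rw [smul_mul_assoc, mul_smul_comm, add_mul, mul_add, one_mul, mul_one, hug]
  have hmg : (1 / 2 : ℂ) • (1 - u) * spinEmbed φ.toEmbedding (toSpin A) =
      spinEmbed φ.toEmbedding (toSpin A) * ((1 / 2 : ℂ) • (1 - u)) := by
    rw [smul_mul_assoc, mul_smul_comm, sub_mul, mul_sub, one_mul, mul_one, hug]
  have hQg : Q * spinEmbed φ.toEmbedding (toSpin A) = spinEmbed φ.toEmbedding (toSpin A) * Q := by
    have h1 : spinEmbed φ.toEmbedding (toSpin (parityAut A)) = Q * spinEmbed φ.toEmbedding (toSpin A) * Q :=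
      spinEmbed_toSpin_parityAut φ A
    rw [hA] at h1
    have h2 : spinEmbed φ.toEmbedding (toSpin A) * Q = Q * spinEmbed φ.toEmbedding (toSpin A) * Q * Q := by rw [← h1]
    rw [mul_assoc, hQQ, mul_one] at h2
    exact h2.symm
  rw [toSpin_fermionEmbed_eq_twist φ hφ A]
  exact twist_conj_of_commute hpm1 hpm hmp hpp hmm hQQ hmQ hpQ hpg hmg hQg

/-- **Odd elements of a final segment carry the string**: for `Θ A = -A`,
`toSpin (Γ^{CAR}_φ A) = P_below · Γ^{spin}_φ (toSpin A)`, `P_below = ⨂_{z ∉ im φ} F_z`.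
[cite: ArakiMoriya2003, §4.1 Def. 4.1–4.3] [cite: EsslerEtAl2005, §12.3.4 eqs. (12.198)–(12.201)] -/
theorem toSpin_fermionEmbed_of_isUpperSet_of_odd (φ : Λ₁ ↪o Λ₂) (hφ : IsUpperSet (Set.range φ))
    {A : Matrix (Finset (Orb Λ₁)) (Finset (Orb Λ₁)) ℂ} (hA : parityAut A = -A) :
    toSpin (fermionEmbed φ.toEmbedding A) =
      productOp (fun z : Λ₂ => if z ∈ rangeSites φ.toEmbedding then (1 : Matrix (Fin 4) (Fin 4) ℂ) else siteParity) *
        spinEmbed φ.toEmbedding (toSpin A) := by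
  set u : Op Λ₂ 4 := productOp (fun z : Λ₂ => if z ∈ rangeSites φ.toEmbedding then (1 : Matrix (Fin 4) (Fin 4) ℂ)
    else siteParity) with hudef
  set Q : Op Λ₂ 4 := productOp (fun z : Λ₂ => if z ∈ rangeSites φ.toEmbedding then siteParity
    else (1 : Matrix (Fin 4) (Fin 4) ℂ)) with hQdef
  have hu : u * u = 1 := productOp_below_mul_self φ
  have hQQ : Q * Q = 1 := blockParity_mul_self φ
  have huQ : u * Q = Q * u := productOp_below_mul_blockParity_comm φ
  obtain ⟨-, hpm, hmp, hpp, hmm, hpmu⟩ := involution_proj (R := Op Λ₂ 4) hu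
  have hug : u * spinEmbed φ.toEmbedding (toSpin A) = spinEmbed φ.toEmbedding (toSpin A) * u :=
    productOp_below_mul_spinEmbed_comm φ (toSpin A)
  have hpQ : (1 / 2 : ℂ) • (1 + u) * Q = Q * ((1 / 2 : ℂ) • (1 + u)) := by
    rw [smul_mul_assoc, mul_smul_comm, add_mul, mul_add, one_mul, mul_one, huQ]
  have hmQ : (1 / 2 : ℂ) • (1 - u) * Q = Q * ((1 / 2 : ℂ) • (1 - u)) := by
    rw [smul_mul_assoc, mul_smul_comm, sub_mul, mul_sub, one_mul, mul_one, huQ]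
  have hpg : (1 / 2 : ℂ) • (1 + u) * spinEmbed φ.toEmbedding (toSpin A) =
      spinEmbed φ.toEmbedding (toSpin A) * ((1 / 2 : ℂ) • (1 + u)) := by
    rw [smul_mul_assoc, mul_smul_comm, add_mul, mul_add, one_mul, mul_one, hug]
  have hmg : (1 / 2 : ℂ) • (1 - u) * spinEmbed φ.toEmbedding (toSpin A) =
      spinEmbed φ.toEmbedding (toSpin A) * ((1 / 2 : ℂ) • (1 - u)) := by
    rw [smul_mul_assoc, mul_smul_comm, sub_mul, mul_sub, one_mul, mul_one, hug]
  have hQg : Q * spinEmbed φ.toEmbedding (toSpin A) = -(spinEmbed φ.toEmbedding (toSpin A) * Q) := by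
    have h1 : spinEmbed φ.toEmbedding (toSpin (parityAut A)) = Q * spinEmbed φ.toEmbedding (toSpin A) * Q :=
      spinEmbed_toSpin_parityAut φ A
    rw [hA, map_neg, map_neg] at h1
    have h2 : Q * spinEmbed φ.toEmbedding (toSpin A) * Q * Q = -spinEmbed φ.toEmbedding (toSpin A) * Q := by rw [← h1]
    rw [mul_assoc, hQQ, mul_one, neg_mul] at h2
    exact h2
  rw [toSpin_fermionEmbed_eq_twist φ hφ A, twist_conj_of_anticommute hpm hmp hpp hmm hQQ hmQ hpQ hpg hmg hQg, hpmu]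

end UpperSet

end JordanWigner

end Literature.MathematicalPhysics.QuantumLattice
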